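import Summits.Ventures.PercRepro.RankLevelSetExplicitLin2All
import Summits.Ventures.PercRepro.RankLevelSetExplicitLin2CellsSucc
import Summits.Ventures.PercRepro.RankLevelSetExplicitLin2UpperWide

/-!
# PercRepro — THE CRUX IS ITS BAND CELLS (p9, S4)

`proofs/SUBCLAIM-S4-p9.md` §S4.3⁗. THEOREM U reduces `C025` to its simple, coloop-free, `e`-free core cells `(p, n)`
with `q + 2 ≤ p ≤ q·2^{q+1}`, `n < Nexp p q` (`c025_of_cells`). At every level `q ≥ 8` four kernel theorems close
most of these cells outright: the uniform theorem (`p ≥ q·2^{q+1} + 1`, `c025_uniform`; at `p = q·2^{q+1}` itself the core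
lemma `c025_core_lin2_bounded` and the large-corank theorem close every core cell), the polynomial CELL MAP
(corank `d ≥ q + 1` with `p ≥ Tcell2 q d k`, `d + 2 ≤ k²`, `3k² ≤ 2^q`: `c025_core_cell_lin2'`), the UPPER END (corank
`d = 5·2^{q−3} − q − 1 + t` past the saturation corank: `c025_core_upper_wide` under the wide cap `q(d+q) ≤ 5(p+1)`,
`3q + 2d + 5 ≤ p` — it subsumes `c025_core_upper_lin2`'s cap `3q(d+q) ≤ 5(p+1)`) and the large-corank theorem (corank
`> q + 2^q` once `p ≥ 2^{q+1} + 2q² + 4q + 4`: `c025_core_explicit_large'`). The predicate `BandOpen q p d` says that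
NONE of them applies to the cell of rank `p` and corank `d`; `rls_core_of_not_band` closes every other core cell, and
`c025_of_band_cells` states the crux as its BAND CELLS: `C025` follows from the core cells whose corank lies in the band.
The band is one or two intervals of coranks (`checks/twin_band.py`: the cell map closes an initial segment, the upper
end an interval past the saturation corank capped by `q(d+q) ≤ 5(p+1)` and `3q + 2d + 5 ≤ p`, which leaves no second
interval once `p ≥ 2^{q+1} + 5q + 5`; e.g. `35 … 668` at `(10, 6 264)`, `24 … 668` at `(10, 5 000)`, `15 … 688` at `(10, 3 840)`).
Nothing here closes a window — the band is exactly the open part of the counting method. Axioms: standard.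
-/

open scoped Matroid

namespace PercRepro

namespace ThmN

variable {α : Type}

/-- **THE BAND**: the `e`-free core cell of rank `p` and corank `d` at level `q` is OPEN for the counting method —
`p` is strictly inside the window (`p < q·2^{q+1}`: at `p = q·2^{q+1}` the uniform chain's core lemma closes every
core cell), the corank is `≥ q + 1` (smaller coranks are trivial), the polynomial
cell map does not reach it (no `k` with `d + 2 ≤ k²`, `3k² ≤ 2^q`, `Tcell2 q d k ≤ p`), the upper end
does not reach it (no `(t, s)` with `d = 5·2^{q−3} − q − 1 + t`, `1 ≤ t`, `2qs ≤ t`, `d ≤ q + 2^q`, `q(d+q) ≤ 5(p+1)`,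
`3q + 2d + 5 ≤ p`, `2(q+5)(5·2^{q−3} − q − 1) ≤ (p+1)·2^s`), and the large-corank theorem does not reach it (`d ≤ q + 2^q` once
`p ≥ 2^{q+1} + 2q² + 4q + 4`). -/
def BandOpen (q p d : ℕ) : Prop :=
  p < q * 2 ^ (q + 1) ∧ q + 1 ≤ d ∧
  (∀ k, d + 2 ≤ k ^ 2 → 3 * k ^ 2 ≤ 2 ^ q → p < Explicit.Tcell2 q d k) ∧
  (∀ t s, d = 5 * 2 ^ (q - 3) - q - 1 + t → 1 ≤ t → 2 * q * s ≤ t → d ≤ q + 2 ^ q →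
    q * (d + q) ≤ 5 * (p + 1) → 3 * q + 2 * d + 5 ≤ p →
    (p + 1) * 2 ^ s < 2 * (q + 5) * (5 * 2 ^ (q - 3) - q - 1)) ∧
  (2 ^ (q + 1) + 2 * q ^ 2 + 4 * q + 4 ≤ p → d ≤ q + 2 ^ q)

/-- **EVERY CORE CELL OUTSIDE THE BAND IS CLOSED** (level `q ≥ 8`): the uniform theorem, the cell map, the upper end
or the large-corank theorem applies. -/
theorem rls_core_of_not_band (q : ℕ) (hq : 8 ≤ q) (M : Matroid α) [M.Finite] (p d : ℕ)
    (hR : M.eRank = (p : ℕ∞)) (hn : M.E.ncard = p + d)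
    (hfree : ∀ e ∈ M.E, ∃ A ⊆ M.E \ {e}, e ∉ M.closure A ∧ e ∉ M.closure ((M.E \ {e}) \ A))
    (hb : ¬ BandOpen q p d) : RLS M p q := by
  classical
  by_cases h1 : q + 1 ≤ d
  swap
  · rcases Nat.lt_or_ge M.E.ncard (p + q) with h | h
    · exact RLS_of_ncard_lt M h
    · exact RLS_of_ncard_eq M (by omega)
  by_cases h0 : q * 2 ^ (q + 1) ≤ p
  · rcases Nat.lt_or_ge (q * 2 ^ (q + 1)) p with hT | hT
    · exact c025_uniform q M p hT
    · -- `p = q·2^{q+1}`: the core lemma of the uniform chain, or the large-corank theorem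
      rcases Nat.lt_or_ge (q + 2 ^ q) d with hbig | hsmall
      · obtain ⟨hN1, -, -, -⟩ := Explicit.Tq_bounds q hq
        exact c025_core_explicit_large' q (by omega) M p (by unfold Explicit.Tq at hN1; omega) hR (by omega) hfree
      · exact c025_core_lin2_bounded q hq M p d (by unfold Explicit.Tq; omega) h1 hsmall hR hn hfree
  by_cases h2 : ∃ k, d + 2 ≤ k ^ 2 ∧ 3 * k ^ 2 ≤ 2 ^ q ∧ Explicit.Tcell2 q d k ≤ p
  · obtain ⟨k, hk, hk3, hp⟩ := h2
    exact c025_core_cell_lin2' q hq M p d k h1 hk hk3 hp hR hn hfree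
  by_cases h3 : ∃ t s, d = 5 * 2 ^ (q - 3) - q - 1 + t ∧ 1 ≤ t ∧ 2 * q * s ≤ t ∧ d ≤ q + 2 ^ q ∧
      q * (d + q) ≤ 5 * (p + 1) ∧ 3 * q + 2 * d + 5 ≤ p ∧
      2 * (q + 5) * (5 * 2 ^ (q - 3) - q - 1) ≤ (p + 1) * 2 ^ s
  · obtain ⟨t, s, hdt, ht1, hts, hd2, hp, hp3, hps⟩ := h3
    exact c025_core_upper_wide q hq M p d t s hdt ht1 hts hd2 hp hp3 hps hR hn hfree
  by_cases h4 : 2 ^ (q + 1) + 2 * q ^ 2 + 4 * q + 4 ≤ p ∧ q + 2 ^ q < d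
  · exact c025_core_explicit_large' q (by omega) M p h4.1 hR (by omega) hfree
  exfalso
  apply hb
  refine ⟨by omega, h1, ?_, ?_, ?_⟩
  · intro k hk hk3
    by_contra hcon
    exact h2 ⟨k, hk, hk3, by omega⟩
  · intro t s hdt ht1 hts hd2 hp hp3
    by_contra hcon
    exact h3 ⟨t, s, hdt, ht1, hts, hd2, hp, hp3, by omega⟩
  · intro hp
    by_contra hcon
    exact h4 ⟨hp, by omega⟩

/-- **THE CRUX IS ITS BAND CELLS**: `C025` follows from the simple, coloop-free, `e`-free core cells `(p, n)` with
`q + 2 ≤ p ≤ q·2^{q+1}`, `n < Nexp p q` (`q ≥ 4`) whose corank `n − p` lies in the BAND at every level `q ≥ 8`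
(at the levels `4 ≤ q ≤ 7` the hypothesis is THEOREM U's list of cells). -/
theorem c025_of_band_cells
    (hcells : ∀ q, 4 ≤ q → ∀ {α : Type} (M : Matroid α) [M.Finite] (p : ℕ), q + 2 ≤ p → p ≤ q * 2 ^ (q + 1) →
      M.E.ncard < Nexp p q → (∀ e ∈ M.E, ∀ f ∈ M.E, e ≠ f → M.eRk {e, f} = 2) → M.eRank = (p : ℕ∞) →
      (∀ e, ¬ M.IsColoop e) →
      (∀ e ∈ M.E, ∃ A ⊆ M.E \ {e}, e ∉ M.closure A ∧ e ∉ M.closure ((M.E \ {e}) \ A)) →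
      (8 ≤ q → BandOpen q p (M.E.ncard - p)) → RLS M p q) : C025 := by
  refine c025_of_cells ?_
  intro q hq α M _ p hpq hpP hn hs hR hc hfree
  by_cases h8 : 8 ≤ q
  · by_cases hb : BandOpen q p (M.E.ncard - p)
    · exact hcells q hq M p hpq hpP hn hs hR hc hfree (fun _ => hb)
    · have hpn : p ≤ M.E.ncard := by
        have h1 := M.eRank_le_encard_ground
        rw [hR, ← M.ground_finite.cast_ncard_eq] at h1
        exact_mod_cast h1
      exact rls_core_of_not_band q h8 M p (M.E.ncard - p) hR (by omega) hfree hb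
  · exact hcells q hq M p hpq hpP hn hs hR hc hfree (fun h => absurd h h8)

/-- **THE CRUX IS ITS BAND CELLS** (both directions). -/
theorem c025_iff_band_cells :
    C025 ↔ (∀ q, 4 ≤ q → ∀ {α : Type} (M : Matroid α) [M.Finite] (p : ℕ), q + 2 ≤ p → p ≤ q * 2 ^ (q + 1) →
      M.E.ncard < Nexp p q → (∀ e ∈ M.E, ∀ f ∈ M.E, e ≠ f → M.eRk {e, f} = 2) → M.eRank = (p : ℕ∞) →
      (∀ e, ¬ M.IsColoop e) →
      (∀ e ∈ M.E, ∃ A ⊆ M.E \ {e}, e ∉ M.closure A ∧ e ∉ M.closure ((M.E \ {e}) \ A)) →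
      (8 ≤ q → BandOpen q p (M.E.ncard - p)) → RLS M p q) :=
  ⟨fun h q _ _ M _ p hpq _ _ _ _ _ _ _ => h M p q hpq, c025_of_band_cells⟩

/-- The band at level `10`, rank `6 264`: the open coranks are `35 … 668` — corank `34` is closed by the cell map
(`k = 6`: `Tcell2 10 34 6 = max 3200 1530 5760 = 5 760 ≤ 6 264`), corank `11` by the cell map at corank `q + 1`
(`k = 4`: `3 840 ≤ 6 264`) and corank `669` by the upper end (`t = 40`, `s = 2`); so `BandOpen 10 6264 d` fails at
`d = 11`, `d = 34` and `d = 669`. -/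
theorem not_bandOpen_ten_thirty_four : ¬ BandOpen 10 6264 34 := by
  intro h
  have := h.2.2.1 6 (by norm_num) (by norm_num)
  unfold Explicit.Tcell2 at this
  norm_num at this

/-- Corank `11 = q + 1` at `(10, 6 264)` is closed by the cell map at corank `q + 1` (`k = 4`: `Tcell2 10 11 4 = 3 840 ≤ 6 264`). -/
theorem not_bandOpen_ten_eleven : ¬ BandOpen 10 6264 11 := by
  intro h
  have := h.2.2.1 4 (by norm_num) (by norm_num)
  unfold Explicit.Tcell2 at this
  norm_num at this

/-- Corank `669 = m_b + 40` at `(10, 6 264)` is closed by the upper end (`t = 40`, `s = 2`: `18 870 ≤ 4·6 265`). -/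
theorem not_bandOpen_ten_six_six_nine : ¬ BandOpen 10 6264 669 := by
  intro h
  have := h.2.2.2.1 40 2 (by norm_num) (by norm_num) (by norm_num) (by norm_num) (by norm_num) (by norm_num)
  norm_num at this

/-- With the wide cap: at rank `3 840` the coranks `689 … 1 034` are closed (`s = 3`), so the band at `(10, 3 840)` is
`15 … 688` — the old cap closed nothing there (`3·10·(689+10) = 20 970 > 5·3 841`). -/
theorem not_bandOpen_ten_thirty_eight_forty : ¬ BandOpen 10 3840 689 := by
  intro h
  have := h.2.2.2.1 60 3 (by norm_num) (by norm_num) (by norm_num) (by norm_num) (by norm_num) (by norm_num)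
  norm_num at this

/-- Level `8`, rank `557`: the coranks `199 … 264` are closed by the wide cap (`t = 48`, `s = 3`). Here `557 < 676 = 2^9 + 2·64 + 32 + 4`,
so the large-corank clause is vacuous and `BandOpen 8 557 d` also holds for every `d ≥ 265`: the band at `(8, 557)` is `9 … 198`
together with every corank `≥ 265`; the rank `557` itself is closed of record by the level-8 row `328 ≤ p` (ADDENDUM 51). -/
theorem not_bandOpen_eight_five_five_seven : ¬ BandOpen 8 557 199 := by
  intro h
  have := h.2.2.2.1 48 3 (by norm_num) (by norm_num) (by norm_num) (by norm_num) (by norm_num) (by norm_num)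
  norm_num at this

end ThmN

end PercRepro
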